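import Mathlib
import HarnessLib

/-!
# ζ(5) search — Families: rises, falls and crossings of a set of positions on the `n`-cycle

HONEST FRAMING: systematic search; no irrationality claim unless certified.

Cell `pub-zeta5`, seat P2.  Pure combinatorics on `ℤ/n = Fin (ℓ + 3)` (the vertex set of Brown's polygons
[Brown2016, §3.1]) used by `Families/BasicConvergenceGeneral.lean` to prove the combinatorial half of
[Brown2016, Lemma 3.6 / Lemma 3.8] for ALL `n`: for a set of positions `T ⊂ ℤ/n`,
* `rises T` / `falls T` / `bdry T` — positions `i` with `i ∉ T, i+1 ∈ T` / `i ∈ T, i+1 ∉ T` / exactly one of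
  `i, i+1` in `T` ("the Hamiltonian cycle `i ↦ i+1` crosses the cut `T | Tᶜ` between `i` and `i+1`");
* `card_bdry_eq_two_mul` — the number of crossings is `2·#rises` (in particular EVEN);
* `arc s k = {s, s+1, …, s+k−1}` (the `v` with `(v − s) mod n < k`), `card_arc`;
* `rises_nonempty` — a non-empty proper `T` is entered at least once;
* `eq_arc_of_card_rises_le_one` — if `T` is entered at most once then `T` is the cyclic run `arc s #T`
  (this is the step "the sum attains `|S₁| − 1` iff the elements of `S₁` are consecutive" of
  [Brown2016, proof of Lemma 3.8], made quantitative);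
* `four_le_card_bdry` — hence a non-empty proper `T` which is NOT a cyclic run is crossed at least four times;
* `card_bdry_arc` — a proper non-empty run is crossed exactly twice.
No statement about zeta values is made here.  (`Fin (ℓ+3)` carries Mathlib's global additive group
structure; the scoped `ℕ → Fin` cast and ring structure are opened inside proofs only.)
-/

namespace Summit.KontsevichZagierPeriods.Zeta5Search.Families.Cellular

open Finset

variable {ℓ : ℕ}

/-! ### Rises, falls, boundary -/

/-- Positions where the cycle `i ↦ i+1` ENTERS `T`: `i ∉ T`, `i + 1 ∈ T`. -/
def rises (T : Finset (Fin (ℓ + 3))) : Finset (Fin (ℓ + 3)) :=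
  univ.filter fun i => i ∉ T ∧ i + 1 ∈ T

/-- Positions where the cycle `i ↦ i+1` LEAVES `T`: `i ∈ T`, `i + 1 ∉ T`. -/
def falls (T : Finset (Fin (ℓ + 3))) : Finset (Fin (ℓ + 3)) :=
  univ.filter fun i => i ∈ T ∧ i + 1 ∉ T

/-- Crossing positions of the cut `T | Tᶜ` by the cycle `i ↦ i+1`: exactly one of `i, i+1` lies in `T`. -/
def bdry (T : Finset (Fin (ℓ + 3))) : Finset (Fin (ℓ + 3)) :=
  univ.filter fun i => ¬ (i ∈ T ↔ i + 1 ∈ T)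

/-- Membership in `rises`. -/
@[simp] theorem mem_rises {T : Finset (Fin (ℓ + 3))} {i : Fin (ℓ + 3)} :
    i ∈ rises T ↔ i ∉ T ∧ i + 1 ∈ T := by
  simp [rises]

/-- Membership in `falls`. -/
@[simp] theorem mem_falls {T : Finset (Fin (ℓ + 3))} {i : Fin (ℓ + 3)} :
    i ∈ falls T ↔ i ∈ T ∧ i + 1 ∉ T := by
  simp [falls]

/-- Membership in `bdry`. -/
@[simp] theorem mem_bdry {T : Finset (Fin (ℓ + 3))} {i : Fin (ℓ + 3)} :
    i ∈ bdry T ↔ ¬ (i ∈ T ↔ i + 1 ∈ T) := by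
  simp [bdry]

/-- The crossings are the rises together with the falls. -/
theorem card_bdry (T : Finset (Fin (ℓ + 3))) : (bdry T).card = (falls T).card + (rises T).card := by
  simp only [bdry, falls, rises, Finset.card_filter]
  rw [← Finset.sum_add_distrib]
  refine Finset.sum_congr rfl fun i _ => ?_
  by_cases h1 : i ∈ T <;> by_cases h2 : i + 1 ∈ T <;> simp [h1, h2]

/-- As many rises as falls (the cycle enters `T` as often as it leaves it). -/
theorem card_falls_eq_card_rises (T : Finset (Fin (ℓ + 3))) : (falls T).card = (rises T).card := by
  -- `B` = positions whose successor lies in `T`; it has `#T` elements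
  set B : Finset (Fin (ℓ + 3)) := univ.filter fun i => i + 1 ∈ T with hB_def
  have hB : B.card = T.card := by
    refine card_nbij' (fun i => i + 1) (fun v => v - 1) ?_ ?_ ?_ ?_
    · intro i hi
      simpa [hB_def] using hi
    · intro v hv
      have : v - 1 + 1 = v := sub_add_cancel v 1
      simpa [hB_def, this] using hv
    · intro i _
      simp
    · intro v _
      simp
  have h1 : (falls T).card + (T.filter fun i => i + 1 ∈ T).card = T.card := by
    rw [add_comm, ← card_filter_add_card_filter_not (s := T) (fun i => i + 1 ∈ T)]
    congr 1
    congr 1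
    ext i
    simp [falls]
  have h2 : (rises T).card + (B.filter fun i => i ∈ T).card = B.card := by
    rw [add_comm, ← card_filter_add_card_filter_not (s := B) (fun i => i ∈ T)]
    congr 1
    congr 1
    ext i
    simp [rises, hB_def, and_comm]
  have h3 : (B.filter fun i => i ∈ T) = T.filter fun i => i + 1 ∈ T := by
    ext i
    simp [hB_def, and_comm]
  rw [h3] at h2
  omega

/-- The number of crossings is twice the number of rises; in particular it is even. -/
theorem card_bdry_eq_two_mul (T : Finset (Fin (ℓ + 3))) : (bdry T).card = 2 * (rises T).card := by
  rw [card_bdry, card_falls_eq_card_rises]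
  ring

/-! ### Cyclic runs (arcs) -/

/-- The cyclic run (arc) `{s, s+1, …, s+k−1} ⊂ ℤ/n`, as the set of `v` with `(v − s) mod n < k`. -/
def arc (s : Fin (ℓ + 3)) (k : ℕ) : Finset (Fin (ℓ + 3)) :=
  univ.filter fun v => ((v - s : Fin (ℓ + 3)) : ℕ) < k

/-- Membership in an arc. -/
@[simp] theorem mem_arc {s : Fin (ℓ + 3)} {k : ℕ} {v : Fin (ℓ + 3)} :
    v ∈ arc s k ↔ ((v - s : Fin (ℓ + 3)) : ℕ) < k := by
  simp [arc]

open Fin.NatCast in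
/-- `s + j ∈ arc s k` for `j < k ≤ n` (internal helper; uses the scoped cast `ℕ → Fin`). -/
theorem add_natCast_mem_arc {s : Fin (ℓ + 3)} {k j : ℕ} (hj : j < k) (hk : k ≤ ℓ + 3) :
    s + (j : Fin (ℓ + 3)) ∈ arc s k := by
  rw [mem_arc, add_sub_cancel_left, Fin.val_cast_of_lt (by omega)]
  exact hj

open Fin.NatCast in
/-- An arc of length `k ≤ n` has `k` elements. -/
theorem card_arc (s : Fin (ℓ + 3)) {k : ℕ} (hk : k ≤ ℓ + 3) : (arc s k).card = k := by
  have h : (arc s k).card = (range k).card := by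
    refine card_nbij' (fun v => ((v - s : Fin (ℓ + 3)) : ℕ)) (fun m => s + (m : Fin (ℓ + 3))) ?_ ?_ ?_ ?_
    · intro v hv
      simpa using hv
    · intro m hm
      have hm' : m < k := by simpa using hm
      exact add_natCast_mem_arc hm' hk
    · intro v _
      simp
    · intro m hm
      have hm' : m < k := by simpa using hm
      simp [Fin.val_cast_of_lt (show m < ℓ + 3 by omega)]
  rwa [card_range] at h

/-! ### At least one rise; one rise forces a run -/

open Fin.NatCast in
/-- A non-empty proper set of positions is entered at least once. -/
theorem rises_nonempty {T : Finset (Fin (ℓ + 3))} (hT : T.Nonempty) (hT' : T ≠ univ) :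
    (rises T).Nonempty := by
  by_contra h
  rw [Finset.not_nonempty_iff_eq_empty] at h
  have step : ∀ i, i ∉ T → i + 1 ∉ T := by
    intro i hi hi1
    have : i ∈ rises T := mem_rises.2 ⟨hi, hi1⟩
    rw [h] at this
    simp at this
  obtain ⟨u, hu⟩ : ∃ u, u ∉ T := by
    by_contra hall
    push Not at hall
    exact hT' (eq_univ_of_forall hall)
  have hall : ∀ j : ℕ, u + (j : Fin (ℓ + 3)) ∉ T := by
    intro j
    induction j with
    | zero => simpa using hu
    | succ j ih =>
      have := step _ ih
      simpa [Nat.cast_succ, add_assoc] using this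
  obtain ⟨t, ht⟩ := hT
  have := hall ((t - u : Fin (ℓ + 3)) : ℕ)
  rw [Fin.cast_val_eq_self, add_sub_cancel] at this
  exact this ht

open Fin.NatCast Fin.CommRing in
/-- **Run lemma.** If a non-empty proper `T` is entered at most once, then `T` is the cyclic run
`arc s #T = {s, s+1, …, s + #T − 1}` for some `s`. [Brown2016, proof of Lemma 3.8] -/
theorem eq_arc_of_card_rises_le_one {T : Finset (Fin (ℓ + 3))} (h : (rises T).card ≤ 1)
    (hT : T.Nonempty) (hT' : T ≠ univ) : ∃ s : Fin (ℓ + 3), T = arc s T.card := by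
  obtain ⟨r, hr⟩ := rises_nonempty hT hT'
  have hr' : ∀ i ∈ rises T, i = r := fun i hi => Finset.card_le_one.1 h i hi r hr
  rw [mem_rises] at hr
  refine ⟨r + 1, ?_⟩
  -- there is no second rise: once the walk from `r + 1` leaves `T` it stays outside until it wraps
  have step : ∀ j : ℕ, j + 1 < ℓ + 3 → r + 1 + (j : Fin (ℓ + 3)) ∉ T →
      r + 1 + ((j + 1 : ℕ) : Fin (ℓ + 3)) ∉ T := by
    intro j hj hout hin
    have hmem : r + 1 + (j : Fin (ℓ + 3)) ∈ rises T := by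
      refine mem_rises.2 ⟨hout, ?_⟩
      simpa [Nat.cast_succ, add_assoc] using hin
    have heq := hr' _ hmem
    have h0 : ((j + 1 : ℕ) : Fin (ℓ + 3)) = 0 := by
      rw [Nat.cast_succ]
      linear_combination heq
    rw [Fin.natCast_eq_zero] at h0
    exact absurd (Nat.le_of_dvd (Nat.succ_pos _) h0) (by omega)
  have stay : ∀ j i : ℕ, r + 1 + (j : Fin (ℓ + 3)) ∉ T → j ≤ i → i < ℓ + 3 →
      r + 1 + (i : Fin (ℓ + 3)) ∉ T := by
    intro j i hj hji
    induction i, hji using Nat.le_induction with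
    | base => exact fun _ => hj
    | succ i _ ih => exact fun hi => step i hi (ih (by omega))
  -- the run `r+1, …, r+#T` lies in `T`
  have hrun : ∀ j : ℕ, j < T.card → r + 1 + (j : Fin (ℓ + 3)) ∈ T := by
    intro j hj
    by_contra hout
    -- otherwise all of `T` lies in `{r+1, …, r+j}`
    have hsub : T ⊆ (Finset.range j).image fun i : ℕ => r + 1 + (i : Fin (ℓ + 3)) := by
      intro v hv
      rw [mem_image]
      refine ⟨((v - (r + 1) : Fin (ℓ + 3)) : ℕ), ?_, ?_⟩
      · rw [mem_range]
        by_contra hge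
        push Not at hge
        refine stay j _ hout hge (Fin.isLt _) ?_
        rwa [Fin.cast_val_eq_self, add_sub_cancel]
      · rw [Fin.cast_val_eq_self, add_sub_cancel]
    have := (card_le_card hsub).trans card_image_le
    rw [card_range] at this
    omega
  -- a set containing a run of its own cardinality is that run
  symm
  apply eq_of_subset_of_card_le
  · intro v hv
    rw [mem_arc] at hv
    have := hrun _ hv
    rwa [Fin.cast_val_eq_self, add_sub_cancel] at this
  · rw [card_arc _ ((card_le_univ T).trans (by simp))]

/-- **Four crossings.** A non-empty proper set of positions which is not a cyclic run is crossed at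
least four times by the cycle `i ↦ i + 1`. [Brown2016, proof of Lemma 3.8] -/
theorem four_le_card_bdry {T : Finset (Fin (ℓ + 3))} (hT : T.Nonempty) (hT' : T ≠ univ)
    (hrun : ¬ ∃ s : Fin (ℓ + 3), T = arc s T.card) : 4 ≤ (bdry T).card := by
  rw [card_bdry_eq_two_mul]
  by_contra hlt
  exact hrun (eq_arc_of_card_rises_le_one (by omega) hT hT')

open Fin.NatCast in
/-- **Two crossings.** A non-empty proper arc `{s, …, s+k−1}` (`1 ≤ k ≤ n − 1`) is crossed exactly twice
(at `s − 1` and at `s + k − 1`). [Brown2016, Lemma 3.8 (case of equality)] -/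
theorem card_bdry_arc (s : Fin (ℓ + 3)) {k : ℕ} (h1 : 1 ≤ k) (hk : k ≤ ℓ + 2) :
    (bdry (arc s k)).card = 2 := by
  have hpair : (({k - 1, ℓ + 2} : Finset ℕ)).card = 2 := card_pair_eq_two_iff.2 (by omega)
  rw [← hpair]
  have e1 : ∀ v : Fin (ℓ + 3),
      ((v + 1 - s : Fin (ℓ + 3)) : ℕ) = (((v - s : Fin (ℓ + 3)) : ℕ) + 1) % (ℓ + 3) := by
    intro v
    rw [add_sub_right_comm, Fin.val_add, Fin.val_one]
  refine card_nbij' (fun v => ((v - s : Fin (ℓ + 3)) : ℕ)) (fun m => s + (m : Fin (ℓ + 3))) ?_ ?_ ?_ ?_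
  · intro v hv
    simp only [coe_filter, bdry, mem_arc, mem_univ, true_and, Set.mem_setOf_eq] at hv
    simp only [coe_insert, coe_singleton, Set.mem_insert_iff, Set.mem_singleton_iff]
    rw [e1] at hv
    have hlt : ((v - s : Fin (ℓ + 3)) : ℕ) < ℓ + 3 := Fin.isLt _
    rcases Nat.lt_or_ge (((v - s : Fin (ℓ + 3)) : ℕ) + 1) (ℓ + 3) with hc | hc
    · rw [Nat.mod_eq_of_lt hc] at hv
      omega
    · have : ((v - s : Fin (ℓ + 3)) : ℕ) + 1 = ℓ + 3 := by omega
      rw [this, Nat.mod_self] at hv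
      omega
  · intro m hm
    simp only [coe_insert, coe_singleton, Set.mem_insert_iff, Set.mem_singleton_iff] at hm
    simp only [coe_filter, bdry, mem_arc, mem_univ, true_and, Set.mem_setOf_eq]
    rw [e1, add_sub_cancel_left, Fin.val_cast_of_lt (show m < ℓ + 3 by omega)]
    rcases hm with rfl | rfl
    · rw [Nat.mod_eq_of_lt (by omega)]
      omega
    · have : ℓ + 2 + 1 = ℓ + 3 := by omega
      rw [this, Nat.mod_self]
      omega
  · intro v _
    simp
  · intro m hm
    simp only [coe_insert, coe_singleton, Set.mem_insert_iff, Set.mem_singleton_iff] at hm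
    simp [Fin.val_cast_of_lt (show m < ℓ + 3 by omega)]

end Summit.KontsevichZagierPeriods.Zeta5Search.Families.Cellular
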